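import Literature.AlgebraicGeometry.Resolution.FBlowup
import Literature.AlgebraicGeometry.Resolution.FrobeniusNormLocalization
import Literature.AlgebraicGeometry.Resolution.BlowupsExistence
import Mathlib.AlgebraicGeometry.RelativeGluing
import Mathlib.AlgebraicGeometry.Cover.Directed
import HarnessLib

/-!
# Existence of F-blowups (Yasuda 2012 / Villamayor 2006, 3.4: patching the local blow-ups)

Topic: `Literature/AlgebraicGeometry/Resolution`. PROVED: **every integral scheme `X` of
characteristic `p` admitting Frobenius norm ideals on its affine opens has an `e`-th F-blowup**
`π : Y → X` (`IsFBlowup p e π`, `FBlowup.lean`), following O. Villamayor U., J. Algebra 295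
(2006), 3.4: "over each affine open, say `Spec(A)`, we blow up at some representative of `[[M]]`.
Any representative defines the same morphism over `Spec(A)`, so it suffices to check that these
morphisms patch; and this follows from the definition of `[[M]]`" — with `M = 𝒪_X^{1/q}` as in
T. Yasuda, *Universal flattening of Frobenius*, Amer. J. Math. 134 (2012), Def. 2.2 / Cor. 2.6.

* `HasFrobeniusNormIdeals p e X` — the hypothesis: every nonempty affine open `U` of `X` carries
  a Frobenius norm ideal `I ⊆ Γ(X, U)` (`IsFrobeniusNormIdeal`), i.e. `[K : K^q] < ∞` for the
  function field `K` and the fractional ideal `[[F^e_* Γ(X, U)]]` has a common denominator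
  (automatic when `X` is F-finite, e.g. of finite type over a perfect field — not proved here).
* `nonemptyAffineCover X` — the locally directed open cover of `X` by its nonempty affine opens.
* `IsFrobeniusNormIdeal.map_presheaf_map` — **representatives restrict to representatives**:
  for nonempty affine opens `U ⊆ V` the extension `I · Γ(X, U)` of a Frobenius norm ideal
  `I ⊆ Γ(X, V)` is a Frobenius norm ideal of `Γ(X, U)` (`FrobeniusNormLocalization.lean`: `U`
  is covered by the basic opens `D(f) ⊆ U`, `f ∈ Γ(X, V)`, and `Γ(X, U) ⊆ Γ(X, D(f)) = Γ(X, V)_f`).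
* `isBlowup_affineBlowup_map_presheaf_map` — hence the blow-up `Bl_{I_U}(U)` of a representative
  on `U` **is also a blowing up of `U` along the restriction of a representative on `V`** (two
  Frobenius norm ideals of `Γ(X, U)` satisfy `f J = g I`, `IsFrobeniusNormIdeal.exists_mul_eq_mul`,
  and isomorphic fractional ideals have the same blowing ups, `BlowupsScaling.lean`).
* `exists_isFBlowup` — **existence**: the `Bl_{I_U}(U) → U` with the transition maps given by the
  universal property form a relative gluing datum over `nonemptyAffineCover X` (cartesian by
  `IsBlowup.isPullback_of_isOpenImmersion`, exactly as for ordinary blowing ups in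
  `BlowupsExistence.lean`) and glue (Mathlib `Scheme.Cover.RelativeGluingData`, Stacks 01LH) to
  `π : Y → X` whose restriction over each `U` is `Bl_{I_U}(U)`.
* `fBlowup hX`, `fBlowup.π hX`, `fBlowup.isFBlowup hX` — a chosen `e`-th F-blowup `FB_e(X) → X`,
  with `fBlowup.isIntegral`, `fBlowup.isProper`, `fBlowup.isBirational`.

## Sources

* O. Villamayor U., J. Algebra 295 (2006) 119–140, Thm. 3.3 and 3.4. [Villamayoru2006]
* T. Yasuda, Amer. J. Math. 134 (2012) 349–378 = arXiv:0706.2700, Def. 2.2, Cor. 2.6. [Yasuda2012]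
* The Stacks Project, Tag 01LH (relative gluing). [StacksProject]
-/

noncomputable section

open CategoryTheory CategoryTheory.Limits AlgebraicGeometry TopologicalSpace

namespace Literature.AlgebraicGeometry.Resolution

universe u

/-! ## The hypothesis: Frobenius norm ideals exist on the affine opens -/

section Hyp

/-- **Frobenius norm ideals exist on the affine opens of `X`**: for every nonempty affine open
`U ⊆ X` some ideal `I ⊆ Γ(X, U)` represents Villamayor's norm `[[F^e_* Γ(X, U)]]` of the
Frobenius push-forward (`IsFrobeniusNormIdeal`). Equivalently: `[K : K^q] < ∞` for the function
field `K` of `X` and the fractional ideals `[[F^e_* Γ(X, U)]]` have common denominators — which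
holds when `X` is F-finite (e.g. of finite type over a perfect field; Yasuda works with varieties
over a perfect field). This is the hypothesis under which the `e`-th F-blowup of `X` exists
(`exists_isFBlowup`). [cite: Villamayoru2006, Thm. 3.3 and 3.4; Yasuda2012, §2.1] -/
def HasFrobeniusNormIdeals (p : ℕ) (e : ℕ) (X : Scheme.{u}) [IsIntegral X]
    [ExpChar X.functionField p] : Prop :=
  ∀ (U : X.affineOpens) [Nonempty (U : X.Opens)],
    ∃ I : Ideal Γ(X, U), IsFrobeniusNormIdeal X.functionField p e I

end Hyp

/-! ## The cover by nonempty affine opens -/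

section Cover

variable (X : Scheme.{u})

/-- The open cover of a scheme by its **nonempty affine opens**. [folklore] -/
def nonemptyAffineCover : X.OpenCover :=
  Scheme.Cover.mkOfCovers (J := {U : X.affineOpens // Nonempty (U : X.Opens)})
    (fun U => (U.1 : X.Opens)) (fun U => (U.1 : X.Opens).ι) fun x => by
      obtain ⟨U, hxU⟩ := IsFBlowup.exists_affineOpens_mem x
      exact ⟨⟨U, ⟨⟨x, hxU⟩⟩⟩, ⟨x, hxU⟩, rfl⟩

/-- The nonempty affine opens are ordered by inclusion. [folklore] -/
instance : Preorder (nonemptyAffineCover X).I₀ :=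
  inferInstanceAs (Preorder {U : X.affineOpens // Nonempty (U : X.Opens)})

/-- The cover by nonempty affine opens is locally directed (by inclusion; the nonempty affine
opens form a basis). [folklore] -/
instance : Scheme.Cover.LocallyDirected (nonemptyAffineCover X) :=
  .ofIsBasisOpensRange
    (fun {U V} => by
      change U.1 ≤ V.1 ↔ ((U.1 : X.Opens).ι).opensRange ≤ ((V.1 : X.Opens).ι).opensRange
      rw [Scheme.Opens.opensRange_ι, Scheme.Opens.opensRange_ι]
      rfl)
    (by
      rw [Opens.isBasis_iff_nbhd]
      intro O x hx
      obtain ⟨W, hW, hxW, hWO⟩ := exists_isAffineOpen_mem_and_subset (X := X) (x := x) (U := O) hx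
      refine ⟨W, ⟨⟨⟨W, hW⟩, ⟨⟨x, hxW⟩⟩⟩, ?_⟩, hxW, hWO⟩
      change ((W : X.Opens).ι).opensRange = W
      exact Scheme.Opens.opensRange_ι _)

/-- The transition maps of the cover are the inclusions. [folklore] -/
@[simp]
theorem nonemptyAffineCover_trans {U V : (nonemptyAffineCover X).I₀} (h : U ≤ V) :
    Scheme.Cover.trans (nonemptyAffineCover X) (homOfLE h) =
      X.homOfLE (show ((U.1 : X.Opens)) ≤ V.1 from h) :=
  rfl

end Cover

/-! ## Representatives restrict to representatives -/

section Restrict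

variable {p : ℕ} {e : ℕ} {X : Scheme.{u}} [IsIntegral X] [ExpChar X.functionField p]

/-- **The extension to a smaller affine open of a Frobenius norm ideal is a Frobenius norm
ideal**: for nonempty affine opens `U ⊆ V` of the integral scheme `X` and a Frobenius norm
ideal `I ⊆ Γ(X, V)`, the ideal `I · Γ(X, U)` is a Frobenius norm ideal of `Γ(X, U)`. Indeed `U`
is covered by the basic opens `D(f) ⊆ U`, `f ∈ Γ(X, V)`, whose restrictions generate the unit
ideal of `Γ(X, U)`, and `Γ(X, U) ⊆ Γ(X, D(f)) = Γ(X, V)[1/f]` (restriction maps of an integral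
scheme are injective), so `frobeniusNorm_eq_span_of_cover` applies.
[cite: Villamayoru2006, 3.4] -/
theorem IsFrobeniusNormIdeal.map_presheaf_map {U V : X.affineOpens} [Nonempty (U : X.Opens)]
    [Nonempty (V : X.Opens)] (hUV : (U : X.Opens) ≤ V) {I : Ideal Γ(X, V)}
    (hI : IsFrobeniusNormIdeal X.functionField p e I) :
    IsFrobeniusNormIdeal X.functionField p e (I.map (X.presheaf.map (homOfLE hUV).op).hom) := by
  letI alg : Algebra Γ(X, V) Γ(X, U) := (X.presheaf.map (homOfLE hUV).op).hom.toAlgebra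
  have halg : ∀ b : Γ(X, V), algebraMap Γ(X, V) Γ(X, U) b = X.presheaf.map (homOfLE hUV).op b :=
    fun b => rfl
  haveI : IsScalarTower Γ(X, V) Γ(X, U) X.functionField := by
    refine IsScalarTower.of_algebraMap_eq fun b => ?_
    rw [halg]
    change X.germToFunctionField V b = X.germToFunctionField U (X.presheaf.map (homOfLE hUV).op b)
    exact (TopCat.Presheaf.germ_res_apply X.presheaf (homOfLE hUV) _ _ b).symm
  -- the covering family: `f ∈ Γ(X, V)` with `D(f) ⊆ U` nonempty
  let S : Set Γ(X, V) := {s | X.basicOpen s ≤ (U : X.Opens) ∧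
    ((X.basicOpen s : X.Opens) : Set X).Nonempty}
  refine hI.map_of_cover S ?_ ?_
  · -- the restrictions of `S` generate the unit ideal of `Γ(X, U)`
    rw [← U.2.iSup_basicOpen_eq_self_iff]
    apply le_antisymm
    · exact iSup_le fun f => X.basicOpen_le _
    · intro x hx
      obtain ⟨f, hfle, hxf⟩ := V.2.exists_basicOpen_le (V := (U : X.Opens)) ⟨x, hx⟩ (hUV hx)
      refine Opens.mem_iSup.mpr ⟨⟨algebraMap Γ(X, V) Γ(X, U) f, f, ⟨hfle, x, hxf⟩, rfl⟩, ?_⟩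
      change x ∈ X.basicOpen (X.presheaf.map (homOfLE hUV).op f)
      rw [Scheme.basicOpen_res]
      exact ⟨hx, hxf⟩
  · -- `Γ(X, U) ⊆ Γ(X, D(s)) = Γ(X, V)[1/s]` for `s ∈ S`
    rintro s ⟨hs, hsne⟩ a'
    haveI : Nonempty (X.basicOpen s) := by
      obtain ⟨y, hy⟩ := hsne
      exact ⟨⟨y, hy⟩⟩
    haveI := V.2.isLocalization_basicOpen s
    let ρ := X.presheaf.map (homOfLE hs).op
    have hρ : Function.Injective ρ := map_injective_of_isIntegral X (homOfLE hs)
    have hρres : ∀ b : Γ(X, V), ρ (algebraMap Γ(X, V) Γ(X, U) b) =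
        algebraMap Γ(X, V) Γ(X, X.basicOpen s) b := fun b => by
      rw [halg]
      change (X.presheaf.map (homOfLE hUV).op ≫ X.presheaf.map (homOfLE hs).op) b = _
      rw [← X.presheaf.map_comp]
      rfl
    obtain ⟨⟨a, ⟨_, k, rfl⟩⟩, h⟩ := IsLocalization.surj (Submonoid.powers s) (ρ a')
    refine ⟨k, a, hρ ?_⟩
    rw [hρres, map_mul, map_pow, hρres, ← h, map_pow, mul_comm]

/-- **The local blow-ups patch** (Villamayor 3.4: "any representative defines the same morphism
over `Spec(A)`"): for nonempty affine opens `U ⊆ V` of `X` and Frobenius norm ideals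
`I_U ⊆ Γ(X, U)`, `I_V ⊆ Γ(X, V)`, the blowing up `Bl_{I_U}(Spec Γ(X, U))` is also a blowing up
along the ideal sheaf of `I_V · Γ(X, U)`: both `I_U` and `I_V · Γ(X, U)` are Frobenius norm
ideals of `Γ(X, U)` (`map_presheaf_map`), hence `f · (I_V Γ(X, U)) = g · I_U` for nonzero `f, g`
(`exists_mul_eq_mul`), and isomorphic fractional ideals have the same blowing ups
(`isBlowup_iff_of_span_singleton_mul_eq`). [cite: Villamayoru2006, 3.4] -/
theorem isBlowup_affineBlowup_map_presheaf_map {U V : X.affineOpens} [Nonempty (U : X.Opens)]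
    [Nonempty (V : X.Opens)] (hUV : (U : X.Opens) ≤ V) {IU : Ideal Γ(X, U)} {IV : Ideal Γ(X, V)}
    (hIU : IsFrobeniusNormIdeal X.functionField p e IU)
    (hIV : IsFrobeniusNormIdeal X.functionField p e IV) :
    IsBlowup (affineBlowup.π IU)
      (affineBlowup.idealSheaf (IV.map (X.presheaf.map (homOfLE hUV).op).hom)) := by
  haveI : IsFractionRing Γ(X, U) X.functionField :=
    functionField_isFractionRing_of_isAffineOpen X U U.2
  obtain ⟨f, g, hf, hg, hfg⟩ := hIU.exists_mul_eq_mul (hIV.map_presheaf_map hUV)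
  exact (isBlowup_iff_of_span_singleton_mul_eq hIU.ne_bot hf hg hfg).mp (affineBlowup.isBlowup IU)

omit [IsIntegral X] [ExpChar X.functionField p] in
/-- The isomorphisms `U ≅ Spec Γ(X, U)` are natural in the affine open `U`. [folklore] -/
theorem homOfLE_isoSpec_hom {U V : X.affineOpens} (hUV : (U : X.Opens) ≤ V) :
    X.homOfLE hUV ≫ V.2.isoSpec.hom =
      U.2.isoSpec.hom ≫ Spec.map (X.presheaf.map (homOfLE hUV).op) := by
  rw [IsAffineOpen.isoSpec_hom, IsAffineOpen.isoSpec_hom,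
    Scheme.Opens.toSpecΓ_SpecMap_presheaf_map]

/-- **`Bl_{I_U}(U) → U` is a blowing up of `U` along the restriction of the ideal sheaf of
`I_V` on `V`** (the previous statement moved through `U ≅ Spec Γ(X, U)`, `V ≅ Spec Γ(X, V)`).
[cite: Villamayoru2006, 3.4] -/
theorem isBlowup_comap_homOfLE {U V : X.affineOpens} [Nonempty (U : X.Opens)]
    [Nonempty (V : X.Opens)] (hUV : (U : X.Opens) ≤ V) {IU : Ideal Γ(X, U)} {IV : Ideal Γ(X, V)}
    (hIU : IsFrobeniusNormIdeal X.functionField p e IU)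
    (hIV : IsFrobeniusNormIdeal X.functionField p e IV) :
    IsBlowup (affineBlowup.π IU ≫ U.2.isoSpec.inv)
      (((affineBlowup.idealSheaf IV).comap V.2.isoSpec.hom).comap (X.homOfLE hUV)) := by
  have h1 := (isBlowup_affineBlowup_map_presheaf_map hUV hIU hIV).comp_iso U.2.isoSpec.symm
  rw [Iso.symm_hom, Iso.symm_inv] at h1
  convert h1 using 1
  rw [← Scheme.IdealSheafData.comap_comp, homOfLE_isoSpec_hom, Scheme.IdealSheafData.comap_comp,
    affineBlowup.idealSheaf, ← CommRingCat.ofHom_hom (X.presheaf.map (homOfLE hUV).op),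
    comap_ofIdealTop_SpecMap]
  rfl

end Restrict

/-! ## Existence -/

section Existence

variable {p : ℕ} {e : ℕ} {X : Scheme.{u}} [IsIntegral X] [ExpChar X.functionField p]

/-- **Existence of F-blowups** (Yasuda 2012, Def. 2.2 / Cor. 2.6, in the form Villamayor 2006,
Thm. 3.3–3.4): an integral scheme `X` of characteristic `p` with Frobenius norm ideals on its
affine opens (`HasFrobeniusNormIdeals`, e.g. a variety over a perfect field) has an `e`-th
F-blowup `π : Y → X`. Proof: choose a representative `I_U ⊆ Γ(X, U)` of `[[F^e_* Γ(X, U)]]` on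
every nonempty affine open `U`; the blowing ups `Bl_{I_U}(U) → U` are blowing ups of `U` along the
restriction of `Ĩ_V` for every `U ⊆ V` (`isBlowup_comap_homOfLE`), so the morphisms
`Bl_{I_U}(U) → Bl_{I_V}(V)` given by the universal property are cartesian
(`IsBlowup.isPullback_of_isOpenImmersion`) and functorial (uniqueness), i.e. form a relative
gluing datum over the locally directed cover of `X` by its nonempty affine opens, which glues
(Stacks 01LH) to `π : Y → X` restricting over each `U` to `Bl_{I_U}(U)`.
[cite: Yasuda2012, Def. 2.2 and Cor. 2.6; Villamayoru2006, Thm. 3.3 and 3.4] -/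
theorem exists_isFBlowup (hX : HasFrobeniusNormIdeals p e X) :
    ∃ (Y : Scheme.{u}) (π : Y ⟶ X), IsFBlowup p e π := by
  classical
  let 𝒰 := nonemptyAffineCover X
  -- representatives on the nonempty affine opens
  have hI' : ∀ U : 𝒰.I₀, ∃ I : Ideal Γ(X, U.1),
      (haveI := U.2; IsFrobeniusNormIdeal X.functionField p e I) :=
    fun U => haveI := U.2; hX U.1
  choose I hI using hI'
  -- the local blowing ups `q U : Bl_{I_U}(U) → U` along `K U`
  let B : 𝒰.I₀ → Scheme.{u} := fun U => affineBlowup (I U)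
  let q : ∀ U : 𝒰.I₀, B U ⟶ (U.1 : X.Opens) := fun U =>
    affineBlowup.π (I U) ≫ U.1.2.isoSpec.inv
  let K : ∀ U : 𝒰.I₀, ((U.1 : X.Opens) : Scheme.{u}).IdealSheafData := fun U =>
    (affineBlowup.idealSheaf (I U)).comap U.1.2.isoSpec.hom
  have hq : ∀ U, IsBlowup (q U) (K U) := fun U => by
    have := (affineBlowup.isBlowup (I U)).comp_iso U.1.2.isoSpec.symm
    rwa [Iso.symm_hom, Iso.symm_inv] at this
  -- KEY (patching): over `U ≤ V`, `Bl_{I_U}(U)` is also a blowing up of `U` along `K V|_U`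
  have hqUV : ∀ {U V : 𝒰.I₀} (h : U ≤ V),
      IsBlowup (q U) ((K V).comap (X.homOfLE (show (U.1 : X.Opens) ≤ V.1 from h))) := by
    intro U V h
    haveI := U.2
    haveI := V.2
    exact isBlowup_comap_homOfLE (show (U.1 : X.Opens) ≤ V.1 from h) (hI U) (hI V)
  -- the Cartier condition producing the transition morphisms
  have hcart : ∀ {U V : 𝒰.I₀} (h : U ≤ V),
      IsEffectiveCartier ((K V).comap (q U ≫ X.homOfLE (show (U.1 : X.Opens) ≤ V.1 from h))) := by
    intro U V h
    rw [Scheme.IdealSheafData.comap_comp]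
    exact (hqUV h).isEffectiveCartier
  -- the functor of local blowing ups over the cover
  let F : 𝒰.I₀ ⥤ Scheme.{u} :=
    { obj := fun U => B U
      map := fun {U V} f => (hq V).lift (q U ≫ X.homOfLE f.le) (hcart f.le)
      map_id := fun U => by
        refine (hq U).hom_ext ?_ ?_
        · rw [(hq U).lift_comp]; exact hcart le_rfl
        · rw [(hq U).lift_comp, Category.id_comp, Scheme.homOfLE_rfl, Category.comp_id]
      map_comp := fun {U V W} f g => by
        refine (hq W).hom_ext ?_ ?_
        · rw [(hq W).lift_comp]; exact hcart (f ≫ g).le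
        · rw [(hq W).lift_comp]
          conv_rhs => rw [Category.assoc, (hq W).lift_comp, ← Category.assoc, (hq V).lift_comp,
            Category.assoc, Scheme.homOfLE_homOfLE] }
  -- the structure maps: a cartesian natural transformation
  let α : F ⟶ 𝒰.functorOfLocallyDirected :=
    { app := fun U => q U
      naturality := fun {U V} f => by
        change (hq V).lift (q U ≫ X.homOfLE f.le) (hcart f.le) ≫ q V = q U ≫ X.homOfLE f.le
        rw [(hq V).lift_comp] }
  have hα : NatTrans.Equifibered α := by
    intro U V f
    change IsPullback ((hq V).lift (q U ≫ X.homOfLE f.le) (hcart f.le)) (q U) (q V)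
      (X.homOfLE f.le)
    exact (hq V).isPullback_of_isOpenImmersion (X.homOfLE f.le) (hqUV f.le) ((hq V).lift_comp _ _)
  let d : 𝒰.RelativeGluingData := ⟨F, α, hα⟩
  -- the glued morphism restricts over each nonempty affine open `U` to `Bl_{I_U}(U)`
  refine ⟨d.glued, d.toBase, ⟨fun U hU => ⟨I ⟨U, hU⟩, hI ⟨U, hU⟩, ?_⟩⟩⟩
  let i : 𝒰.I₀ := ⟨U, hU⟩
  -- `sq1 : IsPullback (q i) (colimit.ι d.functor i) U.ι d.toBase`
  have sq1 := d.isPullback_natTrans_ι_toBase i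
  have sq2 := isPullback_morphismRestrict d.toBase (U : X.Opens)
  have hφ : (sq1.isoIsPullback _ _ sq2).inv ≫ q i = d.toBase ∣_ (U : X.Opens) :=
    sq1.isoIsPullback_inv_fst _ _ sq2
  have h1 : IsBlowup (d.toBase ∣_ (U : X.Opens)) (K i) := by
    have := (hq i).iso_comp (sq1.isoIsPullback _ _ sq2).symm
    rwa [Iso.symm_hom, hφ] at this
  have h2 := h1.comp_iso U.2.isoSpec
  rwa [← Scheme.IdealSheafData.comap_comp, Iso.inv_hom_id, Scheme.IdealSheafData.comap_id] at h2

/-! ## A chosen F-blowup -/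

/-- **The `e`-th F-blowup `FB_e(X)`** of an integral scheme `X` of characteristic `p` with
Frobenius norm ideals on its affine opens: a choice of source of an `e`-th F-blowup
(`exists_isFBlowup`; unique up to isomorphism over `X`). [cite: Yasuda2012, Def. 2.2] -/
def fBlowup (hX : HasFrobeniusNormIdeals p e X) : Scheme.{u} :=
  (exists_isFBlowup hX).choose

/-- The structure morphism `FB_e(X) → X` of the chosen `e`-th F-blowup.
[cite: Yasuda2012, Def. 2.2 and Prop. 2.3] -/
def fBlowup.π (hX : HasFrobeniusNormIdeals p e X) : fBlowup hX ⟶ X :=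
  (exists_isFBlowup hX).choose_spec.choose

/-- The chosen `FB_e(X) → X` is an `e`-th F-blowup. [cite: Yasuda2012, Def. 2.2] -/
theorem fBlowup.isFBlowup (hX : HasFrobeniusNormIdeals p e X) : IsFBlowup p e (fBlowup.π hX) :=
  (exists_isFBlowup hX).choose_spec.choose_spec

/-- `FB_e(X)` is an integral scheme. [cite: Yasuda2012, Cor. 2.6] -/
theorem fBlowup.isIntegral (hX : HasFrobeniusNormIdeals p e X) : IsIntegral (fBlowup hX) :=
  (fBlowup.isFBlowup hX).isIntegral

/-- `FB_e(X) → X` is proper when `X` is locally Noetherian (Yasuda: projective).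
[cite: Yasuda2012, Cor. 2.6] -/
theorem fBlowup.isProper [IsLocallyNoetherian X] (hX : HasFrobeniusNormIdeals p e X) :
    IsProper (fBlowup.π hX) :=
  (fBlowup.isFBlowup hX).isProper

/-- `FB_e(X) → X` is birational. [cite: Yasuda2012, Cor. 2.6] -/
theorem fBlowup.isBirational (hX : HasFrobeniusNormIdeals p e X) :
    IsBirational (fBlowup.π hX) :=
  (fBlowup.isFBlowup hX).isBirational

end Existence

end Literature.AlgebraicGeometry.Resolution

end
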